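import Summits.AtomisticToContinuum.HydrodynamicLimit.Theorems.InformationPercolationEnginePercolationClosesChaosCesaroTelescoping
import Summits.AtomisticToContinuum.HydrodynamicLimit.Theorems.InformationPercolationEnginePercolationClosesChaosCesaroMeasurable
import Summits.AtomisticToContinuum.HydrodynamicLimit.Theorems.InformationPercolationEnginePercolationClosesChaosCesaroTransferLintegral
import HarnessLib

/-!
# Local equilibrium S5 of the line `equilibrium-forecast-chain-rule` (crux `InformationPercolationEngine.PercolationClosesChaos`,
stmt-AtomisticToContinuum-15178) — piece C: the fixed-`N` assembly of `CoarseLocalMaxwellianity` from a static rarity bound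

Support file (`--supports stmt-AtomisticToContinuum-15178`) of the registered stub
`stub_cesaroLocalEquilibrium : PredictableProjection → MesoConditionalEquidistribution → LocalCountUI →
NoMesoscopicOscillation → CoarseLocalMaxwellianity` (worker S5 of lead c3). The S5 audit (Option C) observes that the integrand of
`CoarseLocalMaxwellianity` — the unit-fraction of OCCUPIED `ϑ`-non-Maxwellian cells — splits pointwise into
(regular ∧ non-Maxwellian) + (occupied ∧ packed) + (occupied ∧ inhomogeneous) units, so that ANY large-deviation rarity bound under
the reference law `ν = G_N` for the first fraction, transferred to `μ = LG` by the entropy inequality (pieces T, T′), plus the two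
irregular-unit inputs (`LocalCountUI` (ii) and an inhomogeneity bound guarded by `pop.Nonempty`) bounds the `LG`-expectation — with no
predictable projection, no telescoping and no bin reconstruction. This file proves that fixed-`N` step for arbitrary probability laws
`μ, ν` on the phase space:

* `clmIndicator_le` — the pointwise split of the three indicator families and of their unit averages (`unitAvg_mono`, `unitAvg_add'`);
* `measurable_unitAvg_indicator` — unit averages of indicator families of measurable unit events are measurable (finite box sums);
* `lintegral_nonMaxwellian_le` (registered helper, the headline) — `KL(μ‖ν) ≤ A(N+1)`, `ν{δ' < unitAvg 𝟙{Regular ∧ ϑ ≤ relEntAt}} ≤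
  e^{-L(N+1)}`, `∫⁻ unitAvg 𝟙{occupied ∧ Dense} dμ ≤ δ₁`, `∫⁻ unitAvg 𝟙{occupied ∧ ϑh < inhom} dμ ≤ δ₂` ⇒
  `∫⁻ unitAvg 𝟙{occupied ∧ ϑ < relEntAt} dμ ≤ ofReal (δ' + 27 (log 2 + A)/L) + δ₁ + δ₂`.
-/

noncomputable section

open MeasureTheory Set Filter Topology
open scoped ENNReal BigOperators Classical
open Literature.Analysis.FluidPDE Literature.MathematicalPhysics.KineticTheory
open Literature.MathematicalPhysics.KineticTheory.VelocityBlindPlacement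

namespace Summit.AtomisticToContinuum.HydrodynamicLimit.Theorems.EquilibriumForecastLine

variable {σ : ℝ} {N : ℕ}

/-! ## Unit averages of indicator families -/

/-- An indicator family of unit events guarded by "cell `q` is occupied at the step start" is box-supported. [folklore] -/
theorem indicator_pop_eq_zero_of_not_mem {c : ℝ} (h : 0 < c * meanFreePath σ N) (Φ : Flow σ N) (P : ℕ → Cell → Phase N → Prop)
    {_inst : ∀ (k : ℕ) (q : Cell) (z : Phase N), Decidable ((pop c σ N (Φ.flow ((k : ℝ) * stepLen c σ N) z) q).Nonempty ∧ P k q z)}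
    (z : Phase N) (k : ℕ) {q : Cell} (hq : q ∉ cellBox (c * meanFreePath σ N)) :
    (if (pop c σ N (Φ.flow ((k : ℝ) * stepLen c σ N) z) q).Nonempty ∧ P k q z then (1 : ℝ) else 0) = 0 := by
  rw [if_neg]
  rintro ⟨hne, -⟩
  rw [pop_eq_empty_of_not_mem h _ hq] at hne
  exact Finset.not_nonempty_empty hne

/-- A positive smoothed relative entropy forces an occupied cell (the empty population has `relEnt = 0`). [folklore] -/
theorem pop_nonempty_of_relEntAt_pos {c ϑs t : ℝ} (Φ : Flow σ N) {q : Cell} {z : Phase N}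
    (h : 0 < relEntAt ϑs c σ N Φ t q z) : (pop c σ N (Φ.flow t z) q).Nonempty := by
  by_contra hne
  rw [Finset.not_nonempty_iff_eq_empty] at hne
  unfold relEntAt at h
  rw [hne, relEnt_empty] at h
  exact lt_irrefl _ h

/-- The unit average of an indicator family of MEASURABLE unit events is a measurable function of the phase point (a finite box
sum once the family is box-supported). [folklore] -/
theorem measurable_unitAvg_indicator {c : ℝ} (τ : ℝ) (P : ℕ → Cell → Phase N → Prop) {_inst : ∀ k q z, Decidable (P k q z)}
    (hP : ∀ k q, MeasurableSet {z | P k q z})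
    (hbox : ∀ z k, ∀ q ∉ cellBox (c * meanFreePath σ N), (if P k q z then (1 : ℝ) else 0) = 0) :
    Measurable fun z : Phase N => unitAvg c σ N τ fun k q => if P k q z then (1 : ℝ) else 0 := by
  have heq : (fun z : Phase N => unitAvg c σ N τ fun k q => if P k q z then (1 : ℝ) else 0) = fun z =>
      ((numSteps c σ N τ : ℝ))⁻¹ * (c * meanFreePath σ N) ^ 3 *
        ∑ k ∈ Finset.range (numSteps c σ N τ), ∑ q ∈ cellBox (c * meanFreePath σ N), (if P k q z then (1 : ℝ) else 0) :=
    funext fun z => unitAvg_eq_sum c σ N τ _ (hbox z)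
  rw [heq]
  refine measurable_const.mul (Finset.measurable_sum _ fun k _ => Finset.measurable_sum _ fun q _ => ?_)
  exact Measurable.ite (hP k q) measurable_const measurable_const

/-- **The pointwise split of the `CoarseLocalMaxwellianity` indicator**: occupied ∧ non-Maxwellian ≤ (regular ∧ non-Maxwellian) +
(occupied ∧ packed) + (occupied ∧ inhomogeneous). [folklore] -/
theorem clmIndicator_le (ϑs ϑ ϑh φs c : ℝ) (w : Phase N) (q : Cell) (e : ℝ) :
    (if (pop c σ N w q).Nonempty ∧ ϑ < e then (1 : ℝ) else 0) ≤
      (if Regular ϑs ϑh φs c σ N w q ∧ ϑ ≤ e then (1 : ℝ) else 0) +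
        (if (pop c σ N w q).Nonempty ∧ Dense φs c σ N w q then (1 : ℝ) else 0) +
        (if (pop c σ N w q).Nonempty ∧ ϑh < inhom ϑs w (pop c σ N w q) (nbhd c σ N w q) then (1 : ℝ) else 0) := by
  have h1 : (0 : ℝ) ≤ (if Regular ϑs ϑh φs c σ N w q ∧ ϑ ≤ e then (1 : ℝ) else 0) := by positivity
  have h2 : (0 : ℝ) ≤ (if (pop c σ N w q).Nonempty ∧ Dense φs c σ N w q then (1 : ℝ) else 0) := by positivity
  have h3 : (0 : ℝ) ≤ (if (pop c σ N w q).Nonempty ∧ ϑh < inhom ϑs w (pop c σ N w q) (nbhd c σ N w q)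
      then (1 : ℝ) else 0) := by positivity
  by_cases h : (pop c σ N w q).Nonempty ∧ ϑ < e
  · rw [if_pos h]
    obtain ⟨hne, hlt⟩ := h
    by_cases hD : Dense φs c σ N w q
    · have e2 : (if (pop c σ N w q).Nonempty ∧ Dense φs c σ N w q then (1 : ℝ) else 0) = 1 := if_pos ⟨hne, hD⟩
      linarith
    · by_cases hI : ϑh < inhom ϑs w (pop c σ N w q) (nbhd c σ N w q)
      · have e3 : (if (pop c σ N w q).Nonempty ∧ ϑh < inhom ϑs w (pop c σ N w q) (nbhd c σ N w q)
            then (1 : ℝ) else 0) = 1 := if_pos ⟨hne, hI⟩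
        linarith
      · have hR : Regular ϑs ϑh φs c σ N w q := ⟨hD, not_lt.1 hI⟩
        have e1 : (if Regular ϑs ϑh φs c σ N w q ∧ ϑ ≤ e then (1 : ℝ) else 0) = 1 := if_pos ⟨hR, hlt.le⟩
        linarith
  · rw [if_neg h]
    linarith

/-! ## The fixed-`N` assembly -/

/-- **Registered helper `lintegral_nonMaxwellian_le` (piece C of S5, Option C of the S5 audit): `CoarseLocalMaxwellianity` at fixed
`N` from a static rarity bound.** For probability laws `μ` (evolved) and `ν` (reference) on the phase space with
`KL(μ‖ν) ≤ A(N+1)`, cell size `0 < h ≤ 1`, thresholds `ϑ > 0`, `ϑh`, `φs`, and `δ' ≥ 0`, `L > 0`: if under `ν` the unit-fraction of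
REGULAR `ϑ`-non-Maxwellian cells exceeds `δ'` only with probability `≤ e^{-L(N+1)}`, and under `μ` the unit-fractions of occupied packed
cells and of occupied `ϑh`-inhomogeneous cells have expectation `≤ δ₁`, `≤ δ₂`, then the `μ`-expectation of the unit-fraction of
occupied `ϑ`-non-Maxwellian cells is `≤ δ' + 27 (log 2 + A)/L + δ₁ + δ₂`. [folklore] -/
theorem lintegral_nonMaxwellian_le : ∀ {σ : ℝ} {N : ℕ} (Φ : Flow σ N) (μ ν : Measure (Phase N)) [IsProbabilityMeasure μ] [IsProbabilityMeasure ν] (ϑs ϑh φs : ℝ) {ϑ c τ δ' A L : ℝ} {δ₁ δ₂ : ℝ≥0∞}, 0 < c * meanFreePath σ N → c * meanFreePath σ N ≤ 1 → 0 < ϑ → 0 ≤ δ' → 0 ≤ A → 0 < L → InformationTheory.klDiv μ ν ≤ ENNReal.ofReal (A * ((N : ℝ) + 1)) → ν {z | δ' < unitAvg c σ N τ fun k q => if Regular ϑs ϑh φs c σ N (Φ.flow ((k : ℝ) * stepLen c σ N) z) q ∧ ϑ ≤ relEntAt ϑs c σ N Φ ((k : ℝ) * stepLen c σ N) q z then 1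 else 0} ≤ ENNReal.ofReal (Real.exp (-(L * ((N : ℝ) + 1)))) → ∫⁻ z, ENNReal.ofReal (unitAvg c σ N τ fun k q => if (pop c σ N (Φ.flow ((k : ℝ) * stepLen c σ N) z) q).Nonempty ∧ Dense φs c σ N (Φ.flow ((k : ℝ) * stepLen c σ N) z) q then 1 else 0) ∂μ ≤ δ₁ → ∫⁻ z, ENNReal.ofReal (unitAvg c σ N τ fun k q => if (pop c σ N (Φ.flow ((k : ℝ) * stepLen c σ N) z) q).Nonempty ∧ ϑh < inhom ϑs (Φ.flow ((k : ℝ) * stepLen c σ N) z) (pop c σ N (Φ.flow ((k : ℝ) * stepLen c σ N) z) q) (nbhd c σ N (Φ.flow ((k : ℝ) * stepLen c σ N) z) q) then 1 else 0) ∂μ ≤ δ₂ → ∫⁻ z, ENNReal.ofReal (unitAvg c σ N τ fun k q => if (pop c σ N (Φ.flow ((k : ℝ) * stepLen c σ N) z) q).Nonempty ∧ ϑ < relEntAt ϑs c σ N Φ ((k : ℝ) * stepLen c σ N) q z then 1 else 0) ∂μ ≤ ENNReal.ofReal (δ' + 27 * ((Real.log 2 + A) / L)) + δ₁ + δ₂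 := by
  intro σ N Φ μ ν _ _ ϑs ϑh φs ϑ c τ δ' A L δ₁ δ₂ h0 h1 hϑ hδ' hA hL hKL hν hD hI
  -- the three families and their box support
  set FR : Phase N → ℝ := fun z => unitAvg c σ N τ fun k q =>
    if Regular ϑs ϑh φs c σ N (Φ.flow ((k : ℝ) * stepLen c σ N) z) q ∧
      ϑ ≤ relEntAt ϑs c σ N Φ ((k : ℝ) * stepLen c σ N) q z then (1 : ℝ) else 0 with hFR
  set FD : Phase N → ℝ := fun z => unitAvg c σ N τ fun k q =>
    if (pop c σ N (Φ.flow ((k : ℝ) * stepLen c σ N) z) q).Nonempty ∧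
      Dense φs c σ N (Φ.flow ((k : ℝ) * stepLen c σ N) z) q then (1 : ℝ) else 0 with hFD
  set FI : Phase N → ℝ := fun z => unitAvg c σ N τ fun k q =>
    if (pop c σ N (Φ.flow ((k : ℝ) * stepLen c σ N) z) q).Nonempty ∧
      ϑh < inhom ϑs (Φ.flow ((k : ℝ) * stepLen c σ N) z) (pop c σ N (Φ.flow ((k : ℝ) * stepLen c σ N) z) q)
        (nbhd c σ N (Φ.flow ((k : ℝ) * stepLen c σ N) z) q) then (1 : ℝ) else 0 with hFI
  have hboxR : ∀ (z : Phase N) (k : ℕ), ∀ q ∉ cellBox (c * meanFreePath σ N),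
      (if Regular ϑs ϑh φs c σ N (Φ.flow ((k : ℝ) * stepLen c σ N) z) q ∧
        ϑ ≤ relEntAt ϑs c σ N Φ ((k : ℝ) * stepLen c σ N) q z then (1 : ℝ) else 0) = 0 := by
    intro z k q hq
    rw [if_neg]
    rintro ⟨-, hle⟩
    rw [relEntAt_eq_zero_of_not_mem h0 ϑs Φ _ hq] at hle
    exact absurd hle (not_le.2 hϑ)
  have hboxD : ∀ (z : Phase N) (k : ℕ), ∀ q ∉ cellBox (c * meanFreePath σ N),
      (if (pop c σ N (Φ.flow ((k : ℝ) * stepLen c σ N) z) q).Nonempty ∧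
        Dense φs c σ N (Φ.flow ((k : ℝ) * stepLen c σ N) z) q then (1 : ℝ) else 0) = 0 :=
    fun z k q hq => indicator_pop_eq_zero_of_not_mem h0 Φ
      (fun k q z => Dense φs c σ N (Φ.flow ((k : ℝ) * stepLen c σ N) z) q) z k hq
  have hboxI : ∀ (z : Phase N) (k : ℕ), ∀ q ∉ cellBox (c * meanFreePath σ N),
      (if (pop c σ N (Φ.flow ((k : ℝ) * stepLen c σ N) z) q).Nonempty ∧
        ϑh < inhom ϑs (Φ.flow ((k : ℝ) * stepLen c σ N) z) (pop c σ N (Φ.flow ((k : ℝ) * stepLen c σ N) z) q)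
          (nbhd c σ N (Φ.flow ((k : ℝ) * stepLen c σ N) z) q) then (1 : ℝ) else 0) = 0 :=
    fun z k q hq => indicator_pop_eq_zero_of_not_mem h0 Φ (fun k q z =>
      ϑh < inhom ϑs (Φ.flow ((k : ℝ) * stepLen c σ N) z) (pop c σ N (Φ.flow ((k : ℝ) * stepLen c σ N) z) q)
        (nbhd c σ N (Φ.flow ((k : ℝ) * stepLen c σ N) z) q)) z k hq
  have hboxC : ∀ (z : Phase N) (k : ℕ), ∀ q ∉ cellBox (c * meanFreePath σ N),
      (if (pop c σ N (Φ.flow ((k : ℝ) * stepLen c σ N) z) q).Nonempty ∧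
        ϑ < relEntAt ϑs c σ N Φ ((k : ℝ) * stepLen c σ N) q z then (1 : ℝ) else 0) = 0 :=
    fun z k q hq => indicator_pop_eq_zero_of_not_mem h0 Φ
      (fun k q z => ϑ < relEntAt ϑs c σ N Φ ((k : ℝ) * stepLen c σ N) q z) z k hq
  -- pointwise split of the unit averages
  have hsplit : ∀ z, (unitAvg c σ N τ fun k q =>
      if (pop c σ N (Φ.flow ((k : ℝ) * stepLen c σ N) z) q).Nonempty ∧
        ϑ < relEntAt ϑs c σ N Φ ((k : ℝ) * stepLen c σ N) q z then (1 : ℝ) else 0) ≤ FR z + FD z + FI z := by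
    intro z
    rw [hFR, hFD, hFI]
    simp only
    rw [← unitAvg_add' τ (hboxR z) (hboxD z), ← unitAvg_add' τ (fun k q hq => by rw [hboxR z k q hq, hboxD z k q hq, add_zero])
      (hboxI z)]
    refine unitAvg_mono h0.le (hboxC z) (fun k q hq => by rw [hboxR z k q hq, hboxD z k q hq, hboxI z k q hq]; ring) ?_
    intro k q
    exact clmIndicator_le ϑs ϑ ϑh φs c _ q _
  have hR0 : ∀ z, 0 ≤ FR z := fun z =>
    unitAvg_nonneg h0.le (hboxR z) fun k q => by positivity
  have hD0 : ∀ z, 0 ≤ FD z := fun z =>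
    unitAvg_nonneg h0.le (hboxD z) fun k q => by positivity
  have hI0 : ∀ z, 0 ≤ FI z := fun z =>
    unitAvg_nonneg h0.le (hboxI z) fun k q => by positivity
  have hR27 : ∀ z, FR z ≤ 27 := fun z => by
    have := unitAvg_le_mul_of_le τ zero_le_one h0 h1 (hboxR z) (fun k q => by split_ifs <;> norm_num)
    linarith
  -- measurability of the regular and the packed families
  have hmR : Measurable FR := by
    refine measurable_unitAvg_indicator τ (fun k q z => Regular ϑs ϑh φs c σ N (Φ.flow ((k : ℝ) * stepLen c σ N) z) q ∧
      ϑ ≤ relEntAt ϑs c σ N Φ ((k : ℝ) * stepLen c σ N) q z) (fun k q => ?_) hboxR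
    exact (measurableSet_regular_flow Φ ϑs ϑh φs c _ q).inter
      (measurableSet_le measurable_const (measurable_relEntAt Φ ϑs c _ q))
  have hmD : Measurable FD := by
    refine measurable_unitAvg_indicator τ (fun k q z => (pop c σ N (Φ.flow ((k : ℝ) * stepLen c σ N) z) q).Nonempty ∧
      Dense φs c σ N (Φ.flow ((k : ℝ) * stepLen c σ N) z) q) (fun k q => ?_) hboxD
    exact ((measurableSet_pop_nonempty c σ q).preimage (Φ.measurable_flow _)).inter
      ((measurableSet_dense φs c σ q).preimage (Φ.measurable_flow _))
  -- integrate
  have hRint : ∫⁻ z, ENNReal.ofReal (FR z) ∂μ ≤ ENNReal.ofReal (δ' + 27 * ((Real.log 2 + A) / L)) :=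
    lintegral_ofReal_le_of_measure_le_exp μ ν FR hδ' (by norm_num) hR27 hA hL N hν hKL
  calc ∫⁻ z, ENNReal.ofReal (unitAvg c σ N τ fun k q =>
        if (pop c σ N (Φ.flow ((k : ℝ) * stepLen c σ N) z) q).Nonempty ∧
          ϑ < relEntAt ϑs c σ N Φ ((k : ℝ) * stepLen c σ N) q z then (1 : ℝ) else 0) ∂μ
      ≤ ∫⁻ z, ENNReal.ofReal (FR z) + ENNReal.ofReal (FD z) + ENNReal.ofReal (FI z) ∂μ := by
        refine lintegral_mono fun z => ?_
        rw [← ENNReal.ofReal_add (hR0 z) (hD0 z), ← ENNReal.ofReal_add (add_nonneg (hR0 z) (hD0 z)) (hI0 z)]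
        exact ENNReal.ofReal_le_ofReal (hsplit z)
    _ = (∫⁻ z, ENNReal.ofReal (FR z) ∂μ) + (∫⁻ z, ENNReal.ofReal (FD z) ∂μ) + ∫⁻ z, ENNReal.ofReal (FI z) ∂μ := by
        have hRD : Measurable fun z => ENNReal.ofReal (FR z) + ENNReal.ofReal (FD z) :=
          hmR.ennreal_ofReal.add hmD.ennreal_ofReal
        rw [lintegral_add_left hRD, lintegral_add_left hmR.ennreal_ofReal]
    _ ≤ ENNReal.ofReal (δ' + 27 * ((Real.log 2 + A) / L)) + δ₁ + δ₂ := by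
        gcongr

end Summit.AtomisticToContinuum.HydrodynamicLimit.Theorems.EquilibriumForecastLine

end
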